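import Summits.CriticalPhenomena.Ising3DConformalLimit.Theorems.EnergyNotSigmaSquaredGapForcesFarMergingRootOpacityAvoid
import HarnessLib

/-! # Finite-energy floor for the trace of a sourced double current across a hole
(line `one-cluster-depletion-sandwich` of crux `GapForcesFarMerging`, item stmt-CriticalPhenomena-4468;
helper file of stub `stub_octaveCounting`, registered helper `traceLawHoleFloor`, the one-current half of the
NEAR-PINCH FLOOR)

For `β = β_c(3)`, a hole `S ⊆ Λ_R`, a set `P ⊆ Λ_{R+1}` disjoint from `S` containing the source `a` and a
shell site `w ∈ Λ_{R+1} ∖ Λ_R` with `⟨σ_aσ_w⟩_P > 0` (an escape segment), there is `δ(R,S,P) > 0` such that for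
every `n ≥ R+1` and every far end `v ∈ Λ_n ∖ Λ_R`, the trace law `P^{av,∅}_{Λ_n}` of `n₁+n₂` gives the event
"no open pair at any site of `S`" probability `≥ δ` — uniformly in `n` and in the far end `v`
(`traceLaw_hole_ge`). Steps:
* `twoPoint_hole_lower`: `⟨σ_aσ_v⟩_{Λ_n∖S} ≥ c⟨σ_aσ_v⟩_{Λ_n}` (GKS II chain through `w`, volume monotonicity,
  finite energy across the hole `Λ_R`, `finiteEnergy_boxHole` of the sibling file `…RootFiniteEnergyBox`);
* `isingExpect_spinProduct_expNegBonds_hole`: the tilt identity `⟨σ_A e^{-βK_F}⟩_{Λ_n} = ⟨σ_A⟩_{Λ_n∖S}⟨e^{-βK_F}⟩_{Λ_n}`,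
  `F = ℰ^b(S)` (change of graph as a tilt, `isingExpect_free_mul_of_le`);
* `holeCylinder_real_ge`: `P^{A,∅}_{Λ_n}[n₁+n₂ ≡ 0 on F] = (⟨σ_A e^{-βK_F}⟩/⟨σ_A⟩)·⟨e^{-βK_F}⟩ ≥ e^{-2β|F|}⟨σ_A⟩_{Λ_n∖S}/⟨σ_A⟩_{Λ_n}`
  (factorisation of `P^{A,∅}` on cylinders and ADS15 (2.13)–(2.14) with sources, `sourcedAvoid_eq_div`);
* push-forward along the trace map (`Measure.le_map_apply`).
References: Aizenman–Duminil-Copin–Sidoravicius 2015, (2.13)–(2.14); Aizenman–Duminil-Copin 2021, §3.1;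
Friedli–Velenik 2017, Thm. 3.20, Exercises 3.12, 3.31; Burton–Keane 1989 (finite energy). -/

noncomputable section

namespace Summit.CriticalPhenomena.Ising3DConformalLimit.EnergyNotSigmaSquaredGapForcesFarMergingSandwich

namespace NearPinchFloorProof

open scoped symmDiff ENNReal
open MeasureTheory Filter
open Literature.Probability.LatticeModels Literature.Probability.Percolation
open Summit.CriticalPhenomena.Ising3DConformalLimit.EnergyNotSigmaSquaredGapForcesFarMerging

/-! ### Two-point floor across a hole with an escape segment -/

/-- **Two-point floor across a hole with an escape segment.** For `β > 0`, a hole `S ⊆ Λ_R`, a set `P`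
disjoint from `S` inside `Λ_{R+1}` containing `a` and a shell site `w ∈ Λ_{R+1} ∖ Λ_R` with
`⟨σ_aσ_w⟩_P > 0`: there is `c > 0` with `c·⟨σ_aσ_v⟩_{Λ_n} ≤ ⟨σ_aσ_v⟩_{Λ_n∖S}` for all `n ≥ R+1` and all
`v ∈ Λ_n ∖ Λ_R` (GKS II chain through `w`, volume monotonicity, finite energy across the hole `Λ_R`).
[cite: FriedliVelenik2017, Exercise 3.31] -/
theorem twoPoint_hole_lower {β : ℝ} (hβ : 0 < β) (R : ℕ) {S P : Finset (Site 3)} (hS : S ⊆ box 3 R)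
    (hPS : Disjoint P S) (hP : P ⊆ box 3 (R + 1)) {a w : Site 3} (ha : a ∈ P)
    (hw : w ∈ box 3 (R + 1) \ box 3 R) (hwP : w ∈ P)
    (hpos : 0 < isingCorr (zdGraph 3) P β 0 .free ({a} ∆ {w})) :
    ∃ c : ℝ, 0 < c ∧ ∀ n : ℕ, R + 1 ≤ n → ∀ v ∈ box 3 n \ box 3 R,
      c * isingCorr (zdGraph 3) (box 3 n) β 0 .free ({a} ∆ {v}) ≤
        isingCorr (zdGraph 3) (box 3 n \ S) β 0 .free ({a} ∆ {v}) := by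
  obtain ⟨C, hC, hFE⟩ := finiteEnergy_boxHole (d := 3) (by norm_num) hβ R
  set cseg := isingCorr (zdGraph 3) P β 0 .free ({a} ∆ {w}) with hcsegdef
  refine ⟨cseg * cseg * C⁻¹, by positivity, fun n hn v hv => ?_⟩
  have hPn : P ⊆ box 3 n := hP.trans (box_mono 3 hn)
  have hPnS : P ⊆ box 3 n \ S := fun x hx =>
    Finset.mem_sdiff.2 ⟨hPn hx, fun hxS => Finset.disjoint_left.1 hPS hx hxS⟩
  have han : a ∈ box 3 n := hPn ha
  have hwn : w ∈ box 3 n := hPn hwP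
  have hvn : v ∈ box 3 n := (Finset.mem_sdiff.1 hv).1
  have hvR : v ∉ box 3 R := (Finset.mem_sdiff.1 hv).2
  have haS : a ∈ box 3 n \ S := hPnS ha
  have hwS : w ∈ box 3 n \ S := hPnS hwP
  have hvS : v ∈ box 3 n \ S := Finset.mem_sdiff.2 ⟨hvn, fun h => hvR (hS h)⟩
  have hboxsub : box 3 n \ box 3 R ⊆ box 3 n \ S := Finset.sdiff_subset_sdiff le_rfl hS
  have h1 : cseg ≤ isingCorr (zdGraph 3) (box 3 n \ S) β 0 .free ({a} ∆ {w}) :=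
    isingCorr_free_le_of_subset _ hβ.le le_rfl (pair_symmDiff_subset ha hwP) hPnS
  have h1' : cseg ≤ isingCorr (zdGraph 3) (box 3 n) β 0 .free ({a} ∆ {w}) :=
    isingCorr_free_le_of_subset _ hβ.le le_rfl (pair_symmDiff_subset ha hwP) hPn
  have h2 : C⁻¹ * isingCorr (zdGraph 3) (box 3 n) β 0 .free ({w} ∆ {v}) ≤
      isingCorr (zdGraph 3) (box 3 n \ box 3 R) β 0 .free ({w} ∆ {v}) := by
    rw [inv_mul_le_iff₀ hC]; exact hFE n hn w hw v hv
  have h3 : isingCorr (zdGraph 3) (box 3 n \ box 3 R) β 0 .free ({w} ∆ {v}) ≤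
      isingCorr (zdGraph 3) (box 3 n \ S) β 0 .free ({w} ∆ {v}) :=
    isingCorr_free_le_of_subset _ hβ.le le_rfl
      (pair_symmDiff_subset (Finset.mem_sdiff.2 ⟨hwn, (Finset.mem_sdiff.1 hw).2⟩) hv) hboxsub
  have h4 : isingCorr (zdGraph 3) (box 3 n) β 0 .free ({w} ∆ {a}) *
      isingCorr (zdGraph 3) (box 3 n) β 0 .free ({a} ∆ {v}) ≤
      isingCorr (zdGraph 3) (box 3 n) β 0 .free ({w} ∆ {v}) :=
    isingCorr_pair_chain _ hwn han hvn hβ.le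
  have h6 : isingCorr (zdGraph 3) (box 3 n \ S) β 0 .free ({a} ∆ {w}) *
      isingCorr (zdGraph 3) (box 3 n \ S) β 0 .free ({w} ∆ {v}) ≤
      isingCorr (zdGraph 3) (box 3 n \ S) β 0 .free ({a} ∆ {v}) :=
    isingCorr_pair_chain _ haS hwS hvS hβ.le
  have hcseg0 : 0 ≤ cseg := hpos.le
  have hA0 : 0 ≤ isingCorr (zdGraph 3) (box 3 n) β 0 .free ({a} ∆ {v}) :=
    GKSInequalities.gks_one_holds _ hβ.le le_rfl (Or.inl rfl) (pair_symmDiff_subset han hvn)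
  have hnn1 : 0 ≤ isingCorr (zdGraph 3) (box 3 n \ S) β 0 .free ({a} ∆ {w}) := hcseg0.trans h1
  calc cseg * cseg * C⁻¹ * isingCorr (zdGraph 3) (box 3 n) β 0 .free ({a} ∆ {v})
      = cseg * (C⁻¹ * (cseg * isingCorr (zdGraph 3) (box 3 n) β 0 .free ({a} ∆ {v}))) := by ring
    _ ≤ isingCorr (zdGraph 3) (box 3 n \ S) β 0 .free ({a} ∆ {w}) *
          (C⁻¹ * isingCorr (zdGraph 3) (box 3 n) β 0 .free ({w} ∆ {v})) := by
        refine mul_le_mul h1 (mul_le_mul_of_nonneg_left ?_ (inv_nonneg.2 hC.le)) (by positivity) hnn1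
        refine le_trans (mul_le_mul_of_nonneg_right ?_ hA0) h4
        rw [symmDiff_comm]; exact h1'
    _ ≤ isingCorr (zdGraph 3) (box 3 n \ S) β 0 .free ({a} ∆ {w}) *
          isingCorr (zdGraph 3) (box 3 n \ S) β 0 .free ({w} ∆ {v}) :=
        mul_le_mul_of_nonneg_left (h2.trans h3) hnn1
    _ ≤ isingCorr (zdGraph 3) (box 3 n \ S) β 0 .free ({a} ∆ {v}) := h6

/-! ### The cylinder "no bond meeting the hole is open" under the sourced double current -/

/-- **Tilt identity across a hole**: for a finite `S`, `F = ℰ^b(S) ⊆ ℰ_{Λ_n}` and `A ⊆ Λ_n ∖ S`,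
`⟨σ_A e^{-βK_F}⟩_{Λ_n} = ⟨σ_A⟩_{Λ_n∖S} · ⟨e^{-βK_F}⟩_{Λ_n}` (change of graph as a tilt,
`isingExpect_free_mul_of_le`, for the graph with the bonds meeting `S` deleted, whose free correlations are
those of the region `Λ_n ∖ S`). [cite: FriedliVelenik2017, Exercise 3.31] -/
theorem isingExpect_spinProduct_expNegBonds_hole (β : ℝ) {n : ℕ} {S : Finset (Site 3)}
    (hFn : edgesTouching (zdGraph 3) S ⊆ edgesIn (zdGraph 3) (box 3 n)) {A : Finset (Site 3)}
    (hA : A ⊆ box 3 n \ S) :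
    isingExpect (zdGraph 3) (box 3 n) β 0 .free
        (fun σ => spinProduct A σ * expNegBonds 3 β (edgesTouching (zdGraph 3) S) σ) =
      isingCorr (zdGraph 3) (box 3 n \ S) β 0 .free A *
        isingExpect (zdGraph 3) (box 3 n) β 0 .free (expNegBonds 3 β (edgesTouching (zdGraph 3) S)) := by
  classical
  set F := edgesTouching (zdGraph 3) S with hF
  -- the hole graph
  let G₁ : SimpleGraph (Site 3) :=
    { Adj := fun x y => (zdGraph 3).Adj x y ∧ x ∉ S ∧ y ∉ S
      symm := ⟨fun x y hxy => ⟨hxy.1.symm, hxy.2.2, hxy.2.1⟩⟩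
      loopless := ⟨fun x hx => (zdGraph 3).irrefl hx.1⟩ }
  haveI : G₁.LocallyFinite := fun v =>
    Fintype.ofFinset (((zdGraph 3).neighborFinset v).filter fun w => v ∉ S ∧ w ∉ S) fun w => by
      simp [G₁, SimpleGraph.mem_neighborSet]
  have hG₁ : ∀ x y, G₁.Adj x y ↔ (zdGraph 3).Adj x y ∧ x ∉ S ∧ y ∉ S := fun _ _ => Iff.rfl
  have hle : G₁ ≤ zdGraph 3 := fun x y hxy => hxy.1
  -- the deleted edges are the bonds meeting the hole
  have hD : edgesIn (zdGraph 3) (box 3 n) \ edgesIn G₁ (box 3 n) = F := by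
    ext e
    rw [Finset.mem_sdiff, mem_edgesIn_iff, mem_edgesIn_iff]
    constructor
    · rintro ⟨⟨he1, he2⟩, he3⟩
      rw [hF, mem_edgesTouching_iff]
      refine ⟨he1, ?_⟩
      by_contra hno
      push Not at hno
      apply he3
      refine ⟨?_, he2⟩
      induction e using Sym2.ind with
      | _ u w =>
        rw [SimpleGraph.mem_edgeSet]
        exact ⟨(SimpleGraph.mem_edgeSet _).1 he1, fun h => hno u h (Sym2.mem_mk_left u w),
          fun h => hno w h (Sym2.mem_mk_right u w)⟩
    · intro he
      have he' := mem_edgesIn_iff.1 (hFn he)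
      refine ⟨he', fun ⟨h1, _⟩ => ?_⟩
      obtain ⟨-, x, hx, hxe⟩ := mem_edgesTouching_iff.1 he
      induction e using Sym2.ind with
      | _ u w =>
        have h := (SimpleGraph.mem_edgeSet G₁).1 h1
        rcases Sym2.mem_iff.1 hxe with rfl | rfl
        · exact h.2.1 hx
        · exact h.2.2 hx
  -- `W · e^{-βK_F} = 1`
  have hWneg : ∀ σ : SpinConfig (Site 3),
      (∏ e ∈ edgesIn (zdGraph 3) (box 3 n) \ edgesIn G₁ (box 3 n), Real.exp (β * bondSpin σ e)) *
        expNegBonds 3 β F σ = 1 := fun σ => by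
    rw [hD, expNegBonds, ← Real.exp_sum, ← Real.exp_add, neg_mul, Finset.mul_sum, add_neg_cancel,
      Real.exp_zero]
  have hmeasA : Measurable fun σ : SpinConfig (Site 3) => spinProduct A σ * expNegBonds 3 β F σ :=
    (measurable_spinProduct A).mul (measurable_expNegBonds 3 β F)
  have h1 := isingExpect_free_mul_of_le hle (box 3 n) β 0 hmeasA
  have h2 := isingExpect_free_mul_of_le hle (box 3 n) β 0 (measurable_expNegBonds 3 β F)
  have hf1 : (fun σ : SpinConfig (Site 3) => spinProduct A σ * expNegBonds 3 β F σ *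
      ∏ e ∈ edgesIn (zdGraph 3) (box 3 n) \ edgesIn G₁ (box 3 n), Real.exp (β * bondSpin σ e)) =
      spinProduct A := by
    funext σ; rw [mul_assoc, mul_comm (expNegBonds 3 β F σ), hWneg, mul_one]
  have hf2 : (fun σ : SpinConfig (Site 3) => expNegBonds 3 β F σ *
      ∏ e ∈ edgesIn (zdGraph 3) (box 3 n) \ edgesIn G₁ (box 3 n), Real.exp (β * bondSpin σ e)) =
      fun _ => 1 := by
    funext σ; rw [mul_comm, hWneg]
  rw [hf1] at h1
  rw [hf2, isingExpect_const] at h2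
  change _ * _ = isingCorr G₁ (box 3 n) β 0 .free A at h1
  set Wexp := isingExpect G₁ (box 3 n) β 0 .free
    (fun σ => ∏ e ∈ edgesIn (zdGraph 3) (box 3 n) \ edgesIn G₁ (box 3 n), Real.exp (β * bondSpin σ e))
    with hWexp
  have hWpos : 0 < Wexp := isingExpect_pos G₁ (box 3 n) β 0 .free
    (Finset.measurable_prod _ fun e _ => Real.measurable_exp.comp ((measurable_bondSpin e).const_mul β))
    fun σ => Finset.prod_pos fun e _ => Real.exp_pos _
  have e1 : isingExpect (zdGraph 3) (box 3 n) β 0 .free (fun σ => spinProduct A σ * expNegBonds 3 β F σ) =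
      isingCorr G₁ (box 3 n) β 0 .free A / Wexp := by rw [eq_div_iff hWpos.ne', h1]
  have e2 : isingExpect (zdGraph 3) (box 3 n) β 0 .free (expNegBonds 3 β F) = 1 / Wexp := by
    rw [eq_div_iff hWpos.ne', h2]
  rw [e1, e2, isingCorr_holeGraph_eq hG₁ hA]
  ring

/-- **The hole cylinder under the sourced double current.** For `β > 0`, a finite hole `S` with
`ℰ^b(S) ⊆ ℰ_{Λ_n}` and sources `A ⊆ Λ_n ∖ S` of even cardinality, the `P^{A,∅}_{Λ_n}`-probability (on pairs
of box currents) that no bond meeting `S` is open in `n₁+n₂` is at least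
`e^{-2β|ℰ^b(S)|} · ⟨σ_A⟩_{Λ_n∖S}/⟨σ_A⟩_{Λ_n}` (factorisation `P^{A,∅} = P^A ⊗ P^∅` on cylinders, ADS15
(2.13)–(2.14) with sources, the tilt identity and `e^{-βK_F} ≥ e^{-β|F|}`).
[cite: AizenmanDuminilCopinSidoraviciusCMP2015, §2.2, eqs. (2.13)–(2.14)] -/
theorem holeCylinder_real_ge {β : ℝ} (hβ : 0 < β) {n : ℕ} {S : Finset (Site 3)}
    (hFn : edgesTouching (zdGraph 3) S ⊆ edgesIn (zdGraph 3) (box 3 n)) {A : Finset (Site 3)}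
    (hA : A ⊆ box 3 n \ S) (hAeven : Even A.card) :
    Real.exp (-(2 * β * (edgesTouching (zdGraph 3) S).card)) *
        (isingCorr (zdGraph 3) (box 3 n \ S) β 0 .free A / isingCorr (zdGraph 3) (box 3 n) β 0 .free A) ≤
      (doubleCurrentMeasure (freeBoxGraph 3 n) β (boxSources 3 n A) ∅).real
        {p | ∀ e ∈ edgesTouching (zdGraph 3) S, e ∉ sourcedTrace 3 n p} := by
  classical
  set F := edgesTouching (zdGraph 3) S with hF
  have hAn : A ⊆ box 3 n := hA.trans Finset.sdiff_subset
  have hZA : currentSum (freeBoxGraph 3 n) β (boxSources 3 n A) ≠ 0 :=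
    (currentSum_boxSources_pos 3 hβ hAn hAeven).ne'
  have hZB : currentSum (freeBoxGraph 3 n) β (boxSources 3 n (∅ : Finset (Site 3))) ≠ 0 := by
    rw [boxSources_empty]; exact (currentSum_empty_pos' _ β).ne'
  -- the event is the pull-back of the cylinder `{ω ∩ F = ∅}`
  have hevent : {p : Current (freeBoxGraph 3 n) × Current (freeBoxGraph 3 n) | ∀ e ∈ F, e ∉ sourcedTrace 3 n p} =
      sourcedTrace 3 n ⁻¹' localCylinder (↑F : Set (Sym2 (Site 3))) ↑(∅ : Finset (Sym2 (Site 3))) := by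
    ext p
    simp only [Set.mem_setOf_eq, Set.mem_preimage, localCylinder, Finset.coe_empty, Set.mem_empty_iff_false,
      iff_false, Finset.mem_coe]
  have hP : (doubleCurrentMeasure (freeBoxGraph 3 n) β (boxSources 3 n A) ∅).real
      {p | ∀ e ∈ F, e ∉ sourcedTrace 3 n p} =
      (sourcedDoubleCurrentLaw 3 n β A ∅).real
        (localCylinder (↑F : Set (Sym2 (Site 3))) ↑(∅ : Finset (Sym2 (Site 3)))) := by
    rw [hevent, measureReal_def, measureReal_def,
      sourcedDoubleCurrentLaw_apply n β A ∅ (measurableSet_localCylinder_coe 3 F _), boxSources_empty]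
  rw [hP, sourcedDoubleCurrentLaw_real_localCylinder_eq 3 n hβ.le hZA hZB (Finset.empty_subset F)]
  simp only [Finset.powerset_empty, Finset.sum_singleton, Finset.union_empty, if_true]
  rw [sourcedTrace_eq_sum 3 n β A (Finset.empty_subset F), sourcedTrace_eq_sum 3 n β ∅ (Finset.empty_subset F)]
  simp only [Finset.powerset_empty, Finset.sum_singleton, Finset.card_empty, pow_zero, one_mul,
    Finset.sdiff_empty, Finset.union_empty]
  rw [sourcedAvoid_eq_div 3 n β hFn hAn, sourcedAvoid_eq_div 3 n β hFn (Finset.empty_subset _),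
    isingCorr_empty, div_one, isingExpect_spinProduct_expNegBonds_hole β hFn hA]
  -- the two factors
  have hApos : 0 < isingCorr (zdGraph 3) (box 3 n) β 0 .free A := isingCorr_free_box_pos 3 hβ hAn hAeven
  have hexp := exp_neg_le_isingExpect_expNegBonds hβ.le (box 3 n) F
  have hfun : (fun σ => spinProduct (∅ : Finset (Site 3)) σ * expNegBonds 3 β F σ) = expNegBonds 3 β F := by
    funext σ; simp [spinProduct]
  have hexp' : Real.exp (-(β * F.card)) ≤ isingExpect (zdGraph 3) (box 3 n) β 0 .free (expNegBonds 3 β F) := by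
    rw [← hfun]; exact hexp
  have hhole0 : 0 ≤ isingCorr (zdGraph 3) (box 3 n \ S) β 0 .free A :=
    GKSInequalities.gks_one_holds _ hβ.le le_rfl (Or.inl rfl) hA
  have hsq : Real.exp (-(2 * β * F.card)) = Real.exp (-(β * F.card)) * Real.exp (-(β * F.card)) := by
    rw [← Real.exp_add]; ring_nf
  rw [hsq]
  calc Real.exp (-(β * F.card)) * Real.exp (-(β * F.card)) *
        (isingCorr (zdGraph 3) (box 3 n \ S) β 0 .free A / isingCorr (zdGraph 3) (box 3 n) β 0 .free A)
      = (isingCorr (zdGraph 3) (box 3 n \ S) β 0 .free A * Real.exp (-(β * F.card)) /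
          isingCorr (zdGraph 3) (box 3 n) β 0 .free A) * Real.exp (-(β * F.card)) := by ring
    _ ≤ (isingCorr (zdGraph 3) (box 3 n \ S) β 0 .free A *
          isingExpect (zdGraph 3) (box 3 n) β 0 .free (expNegBonds 3 β F) /
          isingCorr (zdGraph 3) (box 3 n) β 0 .free A) *
        isingExpect (zdGraph 3) (box 3 n) β 0 .free (fun σ => spinProduct ∅ σ * expNegBonds 3 β F σ) := by
        refine mul_le_mul (div_le_div_of_nonneg_right (mul_le_mul_of_nonneg_left hexp' hhole0) hApos.le)
          hexp (Real.exp_pos _).le ?_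
        exact div_nonneg (mul_nonneg hhole0 ((Real.exp_pos _).le.trans hexp')) hApos.le

/-! ### The floor -/

/-- **The near-pinch floor, one current**: for `β_c(3)`, a hole `S ⊆ Λ_R` and an escape segment `P`
from `a ∈ P` to a shell site `w` (as in `twoPoint_hole_lower`), there is `δ > 0` such that for every
`n ≥ R+1` and every far end `v ∈ Λ_n ∖ Λ_R`, `v ≠ a`, the trace law `P^{av,∅}_{Λ_n}` gives the event
"no open pair at any site of `S`" probability `≥ δ`. [cite: AizenmanDuminilCopinAnnals2021, §3.1] -/
theorem traceLaw_hole_ge (R : ℕ) {S P : Finset (Site 3)} (hS : S ⊆ box 3 R) (hPS : Disjoint P S)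
    (hP : P ⊆ box 3 (R + 1)) {a w : Site 3} (ha : a ∈ P) (hw : w ∈ box 3 (R + 1) \ box 3 R) (hwP : w ∈ P)
    (hpos : 0 < isingCorr (zdGraph 3) P (criticalBeta 3) 0 .free ({a} ∆ {w})) :
    ∃ δ : ℝ, 0 < δ ∧ ∀ n : ℕ, R + 1 ≤ n → ∀ v ∈ box 3 n \ box 3 R, v ≠ a →
      δ ≤ (sourcedDoubleCurrentLaw 3 n (criticalBeta 3) ({a} ∆ {v}) ∅).real
        {ω : BondConfig (Site 3) | ∀ x ∈ S, ∀ z : Site 3, s(x, z) ∉ ω} := by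
  have hβ : 0 < criticalBeta 3 := criticalBeta_pos_holds (d := 3) (by norm_num)
  obtain ⟨c, hc, hcle⟩ := twoPoint_hole_lower hβ R hS hPS hP ha hw hwP hpos
  set F := edgesTouching (zdGraph 3) S with hF
  refine ⟨Real.exp (-(2 * criticalBeta 3 * F.card)) * c, by positivity, fun n hn v hv hva => ?_⟩
  set β := criticalBeta 3 with hβdef
  set A : Finset (Site 3) := {a} ∆ {v} with hA
  have hPn : P ⊆ box 3 n := hP.trans (box_mono 3 hn)
  have han : a ∈ box 3 n := hPn ha
  have haS : a ∉ S := fun h => Finset.disjoint_left.1 hPS ha h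
  have hvn : v ∈ box 3 n := (Finset.mem_sdiff.1 hv).1
  have hvS : v ∉ S := fun h => (Finset.mem_sdiff.1 hv).2 (hS h)
  have hAsub : A ⊆ box 3 n \ S :=
    pair_symmDiff_subset (Finset.mem_sdiff.2 ⟨han, haS⟩) (Finset.mem_sdiff.2 ⟨hvn, hvS⟩)
  have hAn : A ⊆ box 3 n := hAsub.trans Finset.sdiff_subset
  have hAeven : Even A.card := by rw [hA, card_pair_symmDiff (Ne.symm hva)]; exact even_two
  have hFn : F ⊆ edgesIn (zdGraph 3) (box 3 n) := edgesTouching_subset_edgesIn_box hn hS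
  have hApos : 0 < isingCorr (zdGraph 3) (box 3 n) β 0 .free A := isingCorr_free_box_pos 3 hβ hAn hAeven
  have hZA : currentSum (freeBoxGraph 3 n) β (boxSources 3 n A) ≠ 0 :=
    (currentSum_boxSources_pos 3 hβ hAn hAeven).ne'
  have hZB : currentSum (freeBoxGraph 3 n) β (boxSources 3 n (∅ : Finset (Site 3))) ≠ 0 := by
    rw [boxSources_empty]; exact (currentSum_empty_pos' _ β).ne'
  -- the cylinder on pairs of currents
  have hcyl := holeCylinder_real_ge hβ hFn hAsub hAeven
  have hratio : c ≤ isingCorr (zdGraph 3) (box 3 n \ S) β 0 .free A / isingCorr (zdGraph 3) (box 3 n) β 0 .free A := by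
    rw [le_div_iff₀ hApos]; exact hcle n hn v hv
  have hstep : Real.exp (-(2 * β * F.card)) * c ≤
      (doubleCurrentMeasure (freeBoxGraph 3 n) β (boxSources 3 n A) ∅).real
        {p | ∀ e ∈ F, e ∉ sourcedTrace 3 n p} :=
    (mul_le_mul_of_nonneg_left hratio (Real.exp_pos _).le).trans hcyl
  refine hstep.trans ?_
  -- push forward along the trace map
  haveI hprob : IsProbabilityMeasure (doubleCurrentMeasure (freeBoxGraph 3 n) β (boxSources 3 n A) ∅) := by
    have h := isProbabilityMeasure_doubleCurrentMeasure_holds (freeBoxGraph 3 n) hβ.le hZA hZB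
    rwa [boxSources_empty] at h
  haveI hprob' : IsProbabilityMeasure (sourcedDoubleCurrentLaw 3 n β A ∅) :=
    isProbabilityMeasure_sourcedDoubleCurrentLaw hβ.le hZA hZB
  have hsub : {p : Current (freeBoxGraph 3 n) × Current (freeBoxGraph 3 n) | ∀ e ∈ F, e ∉ sourcedTrace 3 n p} ⊆
      sourcedTrace 3 n ⁻¹' {ω : BondConfig (Site 3) | ∀ x ∈ S, ∀ z : Site 3, s(x, z) ∉ ω} :=
    fun p hp => ray_closed_of_cylinder hp
  have hmap : sourcedDoubleCurrentLaw 3 n β A ∅ =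
      (doubleCurrentMeasure (freeBoxGraph 3 n) β (boxSources 3 n A) ∅).map (sourcedTrace 3 n) := by
    rw [sourcedDoubleCurrentLaw, boxSources_empty]
  calc (doubleCurrentMeasure (freeBoxGraph 3 n) β (boxSources 3 n A) ∅).real {p | ∀ e ∈ F, e ∉ sourcedTrace 3 n p}
      ≤ (doubleCurrentMeasure (freeBoxGraph 3 n) β (boxSources 3 n A) ∅).real
          (sourcedTrace 3 n ⁻¹' {ω : BondConfig (Site 3) | ∀ x ∈ S, ∀ z : Site 3, s(x, z) ∉ ω}) :=
        measureReal_mono hsub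
    _ ≤ (sourcedDoubleCurrentLaw 3 n β A ∅).real {ω : BondConfig (Site 3) | ∀ x ∈ S, ∀ z : Site 3, s(x, z) ∉ ω} := by
        rw [measureReal_def, measureReal_def, hmap]
        exact ENNReal.toReal_mono (measure_ne_top _ _)
          (Measure.le_map_apply (measurable_sourcedTrace n).aemeasurable _)

end NearPinchFloorProof

open scoped symmDiff in
open MeasureTheory Literature.Probability.LatticeModels Literature.Probability.Percolation NearPinchFloorProof in
/-- **Trace-law floor across a hole** (registered form of `traceLaw_hole_ge`): at `β_c(3)`, for a hole
`S ⊆ Λ_R` with an escape segment `P ∋ a, w` off `S`, the `P^{av,∅}_{Λ_n}`-probability that the trace `n₁+n₂`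
has no open pair at any site of `S` is bounded below uniformly in `n ≥ R+1` and in the far end
`v ∈ Λ_n ∖ Λ_R`. [cite: AizenmanDuminilCopinSidoraviciusCMP2015, §2.2, eqs. (2.13)–(2.14)] -/
theorem traceLawHoleFloor : ∀ (R : ℕ) (S P : Finset (Site 3)), S ⊆ box 3 R → Disjoint P S → P ⊆ box 3 (R + 1) → ∀ (a w : Site 3), a ∈ P → w ∈ box 3 (R + 1) \ box 3 R → w ∈ P → 0 < isingCorr (zdGraph 3) P (criticalBeta 3) 0 .free ({a} ∆ {w}) → ∃ δ : ℝ, 0 < δ ∧ ∀ n : ℕ, R + 1 ≤ n → ∀ v ∈ box 3 n \ box 3 R, v ≠ a → δ ≤ (sourcedDoubleCurrentLaw 3 n (criticalBeta 3) ({a} ∆ {v}) ∅).real {ω : BondConfig (Site 3) | ∀ x ∈ S, ∀ z : Site 3, s(x, z) ∉ ω} :=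
  fun R _ _ hS hPS hP _ _ ha hw hwP hpos => traceLaw_hole_ge R hS hPS hP ha hw hwP hpos

end Summit.CriticalPhenomena.Ising3DConformalLimit.EnergyNotSigmaSquaredGapForcesFarMergingSandwich

end
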